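import Summits.BirchSwinnertonDyer.BirchSwinnertonDyer.Theorems.GenusKolyvaginAtTwoK4NegPhantomCellDescentBit
import Summits.BirchSwinnertonDyer.BirchSwinnertonDyer.Theorems.GenusKolyvaginAtTwoMazurRubinCor34iSingleton
import HarnessLib

/-!
# Route `GenusKolyvaginAtTwo`, crux K₄⁻ `K4Neg` (stmt-BirchSwinnertonDyer-31526), the phantom cell F4ᵖᵍ — THE HEEGNER DESCENT BIT,
# part 5: FRAMES — (β) is exactly where `hDesc` fails; (α)-primes are Mazur–Rubin lowering primes; K₄⁻ frames carrying the (α)-datum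
# exist beyond every bound (unconditionally)

Seat `bsd-line-gk2-p3` g34 (PROVER seat 3/3, cell `bsd-f1-sign2`), `--supports stmt-BirchSwinnertonDyer-31526 --as helper`.
THEOREMS ONLY (no definition, no named fact, no `sorry`); standard axioms; UNCONDITIONAL (Mazur–Rubin Cor. 3.4 (i) is the tree theorem
`MazurRubin2010.cor34i_singleton_rat_holds`, gk2-p4 g12; Čebotarev is `frobenius_dense`).  **BSD is NOT proved by this file; K4Neg is NOT
proved; nothing is closed.**

* §1 `exists_fixed_root_not_two_dvd_of_kummer_eq_resTorsion` — THE (β) SIDE IS EXACT: if some `P ∈ E(K)` has a half `Q ∈ E_K(K̄)` whose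
  Kummer class is `res_K ξ` (`ξ ≠ 0` dying on `Γ_{ℚ(E[4])}`), then `Q` is fixed by `Γ_{K(E[2^L])}` for every `L ≥ 2` while `P ∉ 2E(K)` — the
  LEAD's `hDesc` FAILS at `(P, M = 1, L)`.  With part 3 §3 this makes «`hDesc` for all points» ⟺ «no point of `E(K)` has `K`-Kummer class
  `res_K ξ`» on the frame (given `Aut`-fixed points odd torsion).
* §2 `not_selmerGroup_le_strictLocalKer_of_not_mem_torsionLocalKer` — on the phantom cell (`ξ ∈ Sel₂(E)`) an (α)-prime `ℓ`
  (`loc_ℓ ξ ≠ 0`) is a Mazur–Rubin LOWERING prime (`Sel₂(E) ⊄ ker loc_ℓ`), the hypothesis of the K₄⁻ twin supply.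
* §3 ★ `exists_alive_primeFrame_of_phantom_selmer` — for `W` globally minimal, `Δ < 0`, `ρ_{E,2^n}` onto, `#Sel₂(W) = 4` and the
  Lawson–Wuthrich class SELMER (the phantom cell), beyond every bound `b` there is a prime `ℓ > b` with `ℓ ∤ Δ_min`, a prime Heegner field
  `K = ℚ(√−ℓ)` with EVERY field clause of K4Neg (imaginary quadratic, `d_K = −ℓ` odd `≠ −3`, Heegner for `N_W`, the two Theorem-B₂
  non-squares, `2` split), a globally minimal twin `Wd ≅ W^{(−ℓ)}` with `#Sel₂(Wd) = 2`, AND the (α)-datum at `ℓ` (`[ξ_E, F·F] ≠ 0` for an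
  arithmetic Frobenius `F` over `ℓ` with `F·F ∈ Γ_{ℚ(E[2])}`) — so the `∃`-parent 23491 can always be framed where part 3's `hDesc` holds.

References: [LawsonWuthrich2016] §3, §7.1; [MazurRubin2010] Prop. 3.3, Cor. 3.4 (i), Lemma 3.5; [GrossLMS1991] §1, §9; [SilvermanAEC2009] VIII.§2.
-/

set_option linter.dupNamespace false -- tree convention: `Summit.BirchSwinnertonDyer.BirchSwinnertonDyer.Theorems` (summit = sub-problem)
set_option autoImplicit false

noncomputable section

open scoped Classical NumberField Pointwise

namespace Summit.BirchSwinnertonDyer.BirchSwinnertonDyer.Theorems.GenusExact.PhantomDescentBit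

open WeierstrassCurve NumberField IsDedekindDomain Field
open Literature.NumberTheory.GaloisRepresentations Literature.NumberTheory.EllipticCurves Rat.HeightOneSpectrum
open Summit.BirchSwinnertonDyer.BirchSwinnertonDyer.Theorems.GenusExact.Lw2PhantomExclusion
open Summit.BirchSwinnertonDyer.BirchSwinnertonDyer.Theorems.GenusKolyTwistingPrime
open Summit.BirchSwinnertonDyer.BirchSwinnertonDyer.Theorems.KolyvaginLowerBoundAtTwo (torsionFixing_le_of_dvd)

/-! ## §1 The (β) side is exact: a point with Kummer class `res_K ξ` breaks `hDesc` -/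

section Beta

variable (W : WeierstrassCurve ℚ) [W.IsElliptic] {K : Type} [Field K] [NumberField K]

/-- **A point of `E(K)` whose `K`-Kummer class is `res_K ξ` breaks `hDesc`.**  Frame: `ρ_{E,2^n}` onto, `K` imaginary quadratic; `ξ ∈ H¹(ℚ, E[2])`
non-zero dying on `Γ_{ℚ(E[4])}`.  If `P ∈ E(K)` and `Q ∈ E_K(K̄)` with `2Q = ι P` have Kummer class `κ(Q) = res_K ξ`, then for every `L ≥ 2`: `Q` is
FIXED by `Γ_{K(E[2^L])}` (`res_K ξ` dies on `Γ_{K(E[4])} ⊇ Γ_{K(E[2^L])}`, gk2-p4 g31; `[κ(Q), ρ] = ρQ − Q`) and yet `P ∉ 2E(K)` (`res_K ξ ≠ 0`).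
So on a (β)-frame (the twin's Selmer generator IS the phantom) the LEAD's `hDesc` is FALSE as stated.  [cite: LawsonWuthrich2016, §3, §7.1]
[cite: SilvermanAEC2009, VIII.§2] -/
theorem exists_fixed_root_not_two_dvd_of_kummer_eq_resTorsion
    (hρ : ∀ n : ℕ, 0 < n → W.HasSurjectiveModNGaloisRep ((2 : ℤ) ^ n)) (hK : IsImaginaryQuadratic K)
    {ξ : galH1Torsion W (2 : ℤ)} (hξ0 : ξ ≠ 0) (hξ4 : ∀ h ∈ torsionFixing W (4 : ℤ), h1Eval W (2 : ℤ) ξ h = 0)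
    (P : (W.baseChange K).toAffine.Point) (Q : geomPoints (W.baseChange K)) (hQ : (2 : ℤ) • Q = toGeomPoints (W.baseChange K) P)
    (hκ : kummerClassTorsion (W.baseChange K) (2 : ℤ) Q (by rw [hQ]; exact toGeomPoints_mem_fixedPoints _ _) = resTorsion W K (2 : ℤ) ξ)
    {L : ℕ} (hL : 2 ≤ L) :
    (∀ ρ ∈ torsionFixing (W.baseChange K) ((2 ^ L : ℕ) : ℤ), ρ • Q = Q) ∧
      ¬ ∃ R : (W.baseChange K).toAffine.Point, (2 : ℤ) • R = P := by
  have hQmem : (2 : ℤ) • Q ∈ MulAction.fixedPoints (absoluteGaloisGroup K) (geomPoints (W.baseChange K)) := by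
    rw [hQ]; exact toGeomPoints_mem_fixedPoints _ _
  obtain ⟨hres0, hres4⟩ := resTorsion_ne_zero_and_forall_torsionFixing_four W hρ hK hξ0 hξ4
  have h4L : (4 : ℤ) ∣ ((2 ^ L : ℕ) : ℤ) := by
    obtain ⟨j, hj⟩ : ∃ j, L = j + 2 := ⟨L - 2, by omega⟩
    exact ⟨((2 ^ j : ℕ) : ℤ), by rw [hj]; push_cast; ring⟩
  have hL4 : torsionFixing (W.baseChange K) ((2 ^ L : ℕ) : ℤ) ≤ torsionFixing (W.baseChange K) (4 : ℤ) :=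
    torsionFixing_le_of_dvd (W.baseChange K) h4L
  have h42 : torsionFixing (W.baseChange K) (4 : ℤ) ≤ torsionFixing (W.baseChange K) (2 : ℤ) :=
    torsionFixing_le_of_dvd (W.baseChange K) (by norm_num)
  refine ⟨fun ρ hρ' ↦ ?_, ?_⟩
  · have h := hres4 ρ (hL4 hρ')
    rw [← hκ] at h
    have h' := congrArg Subtype.val h
    rw [coe_h1Eval_kummerClassTorsion (W.baseChange K) (2 : ℤ) Q hQmem (h42 (hL4 hρ')), ZeroMemClass.coe_zero, sub_eq_zero] at h'
    exact h'
  · rintro ⟨R, hR⟩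
    apply hres0
    rw [← hκ, kummerClassTorsion_eq_zero_iff]
    refine ⟨Q - toGeomPoints (W.baseChange K) R, ?_, ?_⟩
    · rw [mem_geomTorsion_iff, smul_sub, hQ, ← map_zsmul, hR, sub_self]
    · rw [sub_sub_cancel]
      exact toGeomPoints_mem_fixedPoints _ _

end Beta

/-! ## §2 An (α)-prime of the phantom cell is a Mazur–Rubin lowering prime -/

section Alpha

variable (W : WeierstrassCurve ℚ)

/-- **On the phantom cell an (α)-prime is a LOWERING prime**: if `ξ ∈ Sel₂(E)` (the Lawson–Wuthrich class is everywhere Selmer — the definition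
of the phantom cell) and `loc_ℓ ξ ≠ 0` (`ξ ∉ ker (H¹(ℚ,E[2]) → H¹(ℚ_ℓ,E[2]))`), then `Sel₂(E) ⊄ MazurRubin2010.strictLocalKer E ℚ_ℓ 2` — the hypothesis
under which the quadratic twist by the prime Heegner field `ℚ(√−ℓ)` LOWERS the `2`-Selmer rank by one (Mazur–Rubin Cor. 3.4 (i), twin supply of
the K₄⁻ cell).  [cite: MazurRubin2010, Cor. 3.4 (i), Def. 3.1] -/
theorem not_selmerGroup_le_strictLocalKer_of_not_mem_torsionLocalKer {ℓ : ℕ} [Fact ℓ.Prime]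
    {ξ : galH1Torsion W (2 : ℤ)} (hξS : ξ ∈ W.selmerGroup 2) (hloc : ξ ∉ W.torsionLocalKer ℚ_[ℓ] (2 : ℤ)) :
    ¬ W.selmerGroup 2 ≤ MazurRubin2010.strictLocalKer W ℚ_[ℓ] 2 :=
  fun hle ↦ hloc (by rw [← strictLocalKer_eq_torsionLocalKer]; exact hle hξS)

end Alpha

/-! ## §3 K₄⁻ frames carrying the (α)-datum exist beyond every bound -/

section Supply

variable (W : WeierstrassCurve ℚ) [W.IsElliptic] [W.IsGloballyMinimal]

/-- ★ **K₄⁻ FRAMES ON WHICH `hDesc` HOLDS EXIST BEYOND EVERY BOUND (unconditionally).**  `E = W/ℚ` globally minimal with `Δ < 0`, `ρ_{E,2^n}` onto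
for all `n ≥ 1`, `#Sel₂(E) = 4`, and THE PHANTOM CELL: the Lawson–Wuthrich class is Selmer (every non-zero `ξ ∈ H¹(ℚ, E[2])` dying on `Γ_{ℚ(E[4])}`
lies in `Sel₂(E)` — there is exactly one such `ξ`).  Then for every bound `b` there are a prime `ℓ > b` with `ℓ ∤ 2N`, `ℓ ∤ Δ_min`, a prime
Heegner field `K` with `d_K = −ℓ` (imaginary quadratic, `d_K` odd `≠ −3`, Heegner for `N_W`, `d_K·(−|Δ|)` and `d_K·(−2|Δ|)` non-squares, `2` split),
a globally minimal twin `Wd ≅ W^{(d_K)}` with `#Sel₂(Wd) = 2` (Mazur–Rubin lowering at the (α)-prime, §2), AND the (α)-datum: a non-zero `ξ` dying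
on `Γ_{ℚ(E[4])}`, a place `v` with `primesEquiv v = ℓ`, a prime `𝔓₀ ∣ v` and an arithmetic Frobenius `F` at `𝔓₀` with `F·F ∈ Γ_{ℚ(E[2])}` and
`[ξ, F·F] ≠ 0` — exactly the inputs of part 3's `hDesc_of_phantom_alive` / part 4's plug.  (The twin's analytic rank and `y_K` are the frame's
other clauses, untouched here.)  BSD is NOT proved by this.
[cite: MazurRubin2010, Prop. 3.3, Cor. 3.4 (i), Lemma 3.5] [cite: LawsonWuthrich2016, §7.1] [cite: GrossLMS1991, §1 (p. 235)] -/
theorem exists_alive_primeFrame_of_phantom_selmer (hΔ : W.Δ < 0)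
    (hρ : ∀ n : ℕ, 0 < n → W.HasSurjectiveModNGaloisRep ((2 : ℤ) ^ n)) (h4 : Nat.card (W.selmerGroup 2) = 4)
    (hcell : ∀ ξ : galH1Torsion W (2 : ℤ), ξ ≠ 0 → (∀ h ∈ torsionFixing W (4 : ℤ), h1Eval W (2 : ℤ) ξ h = 0) → ξ ∈ W.selmerGroup 2)
    {c₀ : absoluteGaloisGroup ℚ} (hc₀ : IsComplexConjugation (Rat.castHom ℝ) c₀) (b : ℕ) :
    ∃ (ℓ : ℕ) (_ : Fact ℓ.Prime), b < ℓ ∧ ¬ ℓ ∣ 2 * W.conductorNorm ℤ ∧ ¬ (ℓ : ℤ) ∣ minimalDiscriminantInt W ∧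
      ∃ (K : Type) (_ : Field K) (_ : NumberField K), IsImaginaryQuadratic K ∧ discr K = -(ℓ : ℤ) ∧ Odd (discr K) ∧
        discr K ≠ -3 ∧ SatisfiesHeegnerHypothesis (W.conductorNorm ℤ) K ∧
        ¬ IsSquare ((discr K : ℚ) * -|W.Δ|) ∧ ¬ IsSquare ((discr K : ℚ) * (-(2 * |W.Δ|))) ∧
        ((Ideal.span {(2 : ℤ)}).primesOver (𝓞 K)).ncard = 2 ∧
        (∃ (Wd : WeierstrassCurve ℚ) (_ : Wd.IsElliptic) (_ : Wd.IsGloballyMinimal),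
          (∃ C : VariableChange ℚ, C • W.quadraticTwist (discr K : ℚ) = Wd) ∧ Nat.card (Wd.selmerGroup 2) = 2) ∧
        ∃ (ξ : galH1Torsion W (2 : ℤ)), ξ ≠ 0 ∧ (∀ h ∈ torsionFixing W (4 : ℤ), h1Eval W (2 : ℤ) ξ h = 0) ∧
          ∃ (v : HeightOneSpectrum (𝓞 ℚ)) (𝔓₀ : Ideal (absIntegers (𝓞 ℚ) ℚ)) (F : absoluteGaloisGroup ℚ),
            (primesEquiv v : ℕ) = ℓ ∧ 𝔓₀ ∈ v.primesAbove ∧ IsArithFrobAt (𝓞 ℚ) F 𝔓₀ ∧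
            (∀ T : geomTorsion W (2 : ℤ), F • T = c₀ • T) ∧ F * F ∈ torsionFixing W (2 : ℤ) ∧ h1Eval W (2 : ℤ) ξ (F * F) ≠ 0 := by
  have hN : W.conductorNorm ℤ ≠ 0 := (W.conductorNorm_pos_holds).ne'
  have hsurj : W.HasSurjectiveModNGaloisRep 2 := by simpa using hρ 1 one_pos
  have hsurj4 : W.HasSurjectiveModNGaloisRep 4 := by have h := hρ 2 two_pos; norm_num at h; exact h
  -- the (α)-prime of part 1
  obtain ⟨ξ, hξ0, hξ4, hsup⟩ := exists_levelFour_phantom_twistingPrime W hsurj4 hsurj hΔ hc₀ hN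
  obtain ⟨ℓ, hℓF, hbℓ, hℓ2N, hℓ8, hℓp, ⟨v, 𝔓₀, F, hv, -, h𝔓₀, hF, hFc, hF2, hval⟩, hloc⟩ := hsup b
  have hℓ : ℓ.Prime := hℓF.out
  -- it is a lowering prime (the phantom is Selmer on the cell)
  have hns : ¬ W.selmerGroup 2 ≤ MazurRubin2010.strictLocalKer W ℚ_[ℓ] 2 :=
    not_selmerGroup_le_strictLocalKer_of_not_mem_torsionLocalKer W (hcell ξ hξ0 hξ4) hloc
  have hℓN' : ∀ p : ℕ, p.Prime → p ∣ W.conductorNorm ℤ → p ≠ 2 → (ℓ : ZMod p) = -1 := by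
    intro p _ hp _
    have h : ((ℓ + 1 : ℕ) : ZMod p) = 0 := (ZMod.natCast_eq_zero_iff _ _).mpr (hℓp p hp)
    rw [Nat.cast_add, Nat.cast_one] at h
    exact eq_neg_of_add_eq_zero_left h
  obtain ⟨-, hℓΔ, -⟩ := GenusKolyTwin.exists_heegnerField_of_prime W hℓ hℓ8 hℓN'
  -- the prime Heegner field and its `2`-Selmer-minimal twin (Mazur–Rubin Cor. 3.4 (i), a tree theorem)
  obtain ⟨K, _, _, hK, hd, hodd, hd3, hH, hsq1, hsq2, h2K, -, Wd, _, _, hWd, hSelWd⟩ :=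
    GenusKolyTwin.supply_DEF1_of_not_strict_prime W MazurRubin2010.cor34i_singleton_rat_holds hΔ h4 hℓ8 hℓN' hns
  exact ⟨ℓ, hℓF, hbℓ, hℓ2N, hℓΔ, K, inferInstance, inferInstance, hK, hd, hodd, hd3, hH, hsq1, hsq2, h2K,
    ⟨Wd, inferInstance, inferInstance, hWd, hSelWd⟩, ξ, hξ0, hξ4, v, 𝔓₀, F, hv, h𝔓₀, hF, hFc, hF2, hval⟩

end Supply

end Summit.BirchSwinnertonDyer.BirchSwinnertonDyer.Theorems.GenusExact.PhantomDescentBit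

end
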